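import Summits.HodgeConjecture.HodgeConjecture.Theses.PadicSemiregularLift
import Summits.HodgeConjecture.HodgeConjecture.Theorems.PadicSemiregularLiftPadicPridhamSemiregularity

/-!
# `FermatAnchorAssembly` (stmt-HodgeConjecture-14874) after the proof of `PadicPridhamSemiregularity`

The crux is `FermatAnchorAssembly := PadicPridhamSemiregularity → FormalLiftingFromClassLifting →
FormalVectorBundlesAlgebraize → HodgeFermatVarieties` (route `PadicSemiregularLift`). Its first engine
hypothesis P1b `PadicPridhamSemiregularity` (stmt-HodgeConjecture-13815) is now a THEOREM of the tree
(`Theorems.PadicPridhamSemiregularity.padicPridhamSemiregularity_proof`). This file records, sorry-free and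
kernel-checked, what the node then IS:

* `fermatAnchorAssembly_iff_withoutPridham` — UNCONDITIONALLY, the crux is equivalent to
  `FormalLiftingFromClassLifting → FormalVectorBundlesAlgebraize → HodgeFermatVarieties` (P1b has left the node);
* `fermatAnchorAssembly_of_hodgeFermatVarieties` — the crux follows from its consequent, the route item
  `HodgeFermatVarieties` (stmt-HodgeConjecture-1334), in one line (the importable closer for the day 1334 lands);
* `fermatAnchorAssembly_iff_hodgeFermatVarieties_of_remaining_engine` — given the two remaining (unproved)
  engine items P1a `FormalLiftingFromClassLifting` (stmt-13825) and P3a `FormalVectorBundlesAlgebraize`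
  (stmt-14106, Grothendieck existence, a theorem in print), the crux is EQUIVALENT to stmt-1334.

So every closer of this item is a closer of stmt-HodgeConjecture-1334 or a refutation of P1a/P3a as typed
(lead c4 of the line chain, 2026-08-17; cf. the disprover's `FermatAnchorAssemblyNegative.not_fermatAnchorAssembly_iff`
and `…_iff_hodgeFermatVarieties_of_engine`, which carry `h1b` as a hypothesis).
-/

-- `Summit.HodgeConjecture.HodgeConjecture.…` is the tree's mandated summit/problem namespace (single-problem summit).
set_option linter.dupNamespace false

namespace Summit.HodgeConjecture.HodgeConjecture.Theorems.FermatAnchorAssemblyAfterPridham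

open Summit.HodgeConjecture.HodgeConjecture.Theses.PadicSemiregularLift
open Summit.HodgeConjecture.HodgeConjecture.Theorems.PadicPridhamSemiregularity
  (padicPridhamSemiregularity_proof)

/-- **The crux follows from its consequent**: `HodgeFermatVarieties → FermatAnchorAssembly` (the engine
hypotheses are simply dropped). [folklore] -/
theorem fermatAnchorAssembly_of_hodgeFermatVarieties (h : HodgeFermatVarieties) : FermatAnchorAssembly :=
  fun _ _ _ => h

/-- **P1b has left the node**: since `PadicPridhamSemiregularity` is proved, the crux is equivalent to
`FormalLiftingFromClassLifting → FormalVectorBundlesAlgebraize → HodgeFermatVarieties`, unconditionally.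
[folklore] -/
theorem fermatAnchorAssembly_iff_withoutPridham :
    FermatAnchorAssembly ↔
      (FormalLiftingFromClassLifting → FormalVectorBundlesAlgebraize → HodgeFermatVarieties) :=
  ⟨fun h h1a h3a => h padicPridhamSemiregularity_proof h1a h3a, fun h _ h1a h3a => h h1a h3a⟩

/-- **Given the two remaining engine items the crux IS stmt-1334**: under P1a
`FormalLiftingFromClassLifting` and P3a `FormalVectorBundlesAlgebraize`,
`FermatAnchorAssembly ↔ HodgeFermatVarieties` (P1b discharged by its proof). [folklore] -/
theorem fermatAnchorAssembly_iff_hodgeFermatVarieties_of_remaining_engine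
    (h1a : FormalLiftingFromClassLifting) (h3a : FormalVectorBundlesAlgebraize) :
    FermatAnchorAssembly ↔ HodgeFermatVarieties :=
  ⟨fun h => h padicPridhamSemiregularity_proof h1a h3a, fermatAnchorAssembly_of_hodgeFermatVarieties⟩

end Summit.HodgeConjecture.HodgeConjecture.Theorems.FermatAnchorAssemblyAfterPridham
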